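import Summits.QuantumAdvantage.QuantumAdvantage.Theorems.LinnikCubicClassGroupsPureCubicClassGroupFBQPStubClassTableSemCircle
import Summits.QuantumAdvantage.QuantumAdvantage.Theorems.LinnikCubicClassGroupsPureCubicClassGroupFBQPStubSemSetup

/-!
# Crux `LinnikCubicClassGroups.PureCubicClassGroupFBQP` (stmt-QuantumAdvantage-11544) — stub `stub_semMain`, part REGULATOR

Line `arakelov-giant-step-cycle`, stub `stub_semMain` (S5b-P5b-M): the lower bound `log 2 / 6 ≤ R_K` for the regulator of a
pure cubic field, read off the circle package of the unit ideal (the period `n₀ ≥ 1` of the reduced labels satisfies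
`n₀ log 2 ≤ 6 R_K` by the six-gap). It feeds `walk_package` (`hR6`) in the composition of the table semantics.
-/

set_option linter.dupNamespace false

namespace Summit.QuantumAdvantage.QuantumAdvantage.Theorems.LinnikCubicClassGroups

open scoped NumberField nonZeroDivisors
open NumberField

/-- **P5b helper `classTableSem_regulator_ge`** (registered): `log 2 / 6 ≤ R_K` for the pure cubic field `ℚ(θ)`, `θ³ = ab²`. -/
theorem classTableSem_regulator_ge : ∀ (a b : ℕ), Squarefree (a * b) → a * b ≠ 1 → ∀ (K : Type) [Field K] [NumberField K], Module.finrank ℚ K = 3 → ∀ θ : K, θ ^ 3 = ((a * b ^ 2 : ℕ) : K) → ∀ (σ₁ : K →+* ℝ) (σ₂ : K →+* ℂ), (∃ z : K, starRingEnd ℂ (σ₂ z) ≠ σ₂ z) → Real.log 2 / 6 ≤ NumberField.Units.regulator K := by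
  intro a b hab hab1 K _ _ hdeg θ hθ σ₁ σ₂ hσ₂
  obtain ⟨-, n₁, -, -, -, -, hn₁, hn₁R, -⟩ :=
    circle_package (σ₁ := σ₁) hdeg hσ₂ hab hab1 hθ (1 : FractionalIdeal (𝓞 K)⁰ K) one_ne_zero
  exact regulator_ge_of_period hn₁ hn₁R

end Summit.QuantumAdvantage.QuantumAdvantage.Theorems.LinnikCubicClassGroups
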